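import Literature.Computability.QuantumComplexity.AaronsonAmbainis

/-!
# Crux `VarianceAmplification` (stmt-QuantumAdvantage-17874, route RandomOracleGauge), line `average-and-clip` — stub `stub_clip`

The CLIPPING step of the elementary variance amplifier (line card `Cruxes/AAConj/Lines/average-and-clip.md`):
for a cube polynomial `s` with `|s| ≤ 1`, mean `0`, and an admissible outer polynomial `S` of gain `k`
(bounded by `1` on `[−1,1]`, `2k`-Lipschitz there, increasing, slope `≥ k/16` on `|u| ≤ 1/(2k)`), the composite

  `Y = 1/2 + S(s)/2`

is a `[0,1]`-bounded polynomial of total degree `≤ deg S · deg s` with `Inf_j Y ≤ k² Inf_j s` (Lipschitz), and the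
truncated-second-moment bound

  `Var Y ≥ (k/32)² (A·B − C²)`,  `A = E s² − E s⁴/t²`, `B = 1 − E s²/t²`, `C = E s⁴/t³`

for any `0 < t ≤ 1/(2k)` with `A, B ≥ 0`: write `Var Y = (1/2) E_{x,x'} (Y(x) − Y(x'))²`, keep only the pairs with
`|s(x)|, |s(x')| ≤ t` (where `|Y(x) − Y(x')| ≥ (k/32)|s(x) − s(x')|`), and control the discarded zone
`{|s| > t}` by Chebyshev-type moment bounds (`#{|s|>t} ≤ Σ s²/t²`, `Σ_{|s|>t} s² ≤ Σ s⁴/t²`,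
`|Σ_{|s|>t} s| ≤ Σ s⁴/t³`).

* `sum_sum_sq_sub` — `Σ_{x,x'∈Z} (f x − f x')² = 2|Z| Σ_Z f² − 2 (Σ_Z f)²`; `boolVariance_eq_double_sum`;
* `evalBool_clipPoly`, `totalDegree_clipPoly_le`, `influence_clipPoly_le`, `boolVariance_clipPoly_ge`;
* **`stub_clip`** — the registered stub, BY NAME (witness `Y = C(1/2) + C(1/2)·aeval s S`, written inline).

Elementary; no named facts, no new definitions.
-/

-- D-0017: single-conjunct summit ⇒ the duplicate `QuantumAdvantage.QuantumAdvantage` is mandated.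
set_option linter.dupNamespace false

noncomputable section

open Finset
open Literature.Computability.QuantumComplexity

namespace Summit.QuantumAdvantage.QuantumAdvantage.Cruxes.VarianceAmplification.AverageAndClip

namespace StubClip

variable {M : ℕ}

/-! ### Double-sum form of the variance -/

/-- `Σ_{x∈Z} Σ_{x'∈Z} (f x − f x')² = 2|Z|·Σ_{x∈Z} f(x)² − 2(Σ_{x∈Z} f x)²`. [folklore] -/
theorem sum_sum_sq_sub {α : Type*} (Z : Finset α) (f : α → ℝ) :
    ∑ x ∈ Z, ∑ x' ∈ Z, (f x - f x') ^ 2 = 2 * Z.card * ∑ x ∈ Z, f x ^ 2 - 2 * (∑ x ∈ Z, f x) ^ 2 := by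
  have h : ∀ x ∈ Z, ∑ x' ∈ Z, (f x - f x') ^ 2 =
      Z.card * f x ^ 2 + ∑ x' ∈ Z, f x' ^ 2 - 2 * (f x * ∑ x' ∈ Z, f x') := by
    intro x _
    have e : ∀ x' ∈ Z, (f x - f x') ^ 2 = f x ^ 2 + f x' ^ 2 - 2 * (f x * f x') := by
      intro x' _; ring
    rw [Finset.sum_congr rfl e, Finset.sum_sub_distrib, Finset.sum_add_distrib, Finset.sum_const,
      nsmul_eq_mul, ← Finset.mul_sum, ← Finset.mul_sum]
  rw [Finset.sum_congr rfl h, Finset.sum_sub_distrib, Finset.sum_add_distrib, Finset.sum_const, nsmul_eq_mul,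
    ← Finset.mul_sum, ← Finset.mul_sum, ← Finset.sum_mul]
  ring

/-- **Variance as a double sum**: `Var q = Σ_{x,x'} (q x − q x')² / (2·4^M)`. [folklore] -/
theorem boolVariance_eq_double_sum (q : MvPolynomial (Fin M) ℝ) :
    boolVariance q = (∑ x : Fin M → Bool, ∑ x' : Fin M → Bool, (evalBool q x - evalBool q x') ^ 2) /
      (2 * ((2 : ℝ) ^ M) ^ 2) := by
  rw [sum_sum_sq_sub]
  unfold boolVariance boolAvg
  simp only [Finset.card_univ, Fintype.card_fun, Fintype.card_bool, Fintype.card_fin]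
  push_cast
  set T := ∑ x : Fin M → Bool, evalBool q x with hT
  have h2 : (2 : ℝ) ^ M ≠ 0 := by positivity
  have key1 : ∀ a n : ℝ, n ≠ 0 → a + n * (T / n) ^ 2 - 2 * (T / n) * T = a - T ^ 2 / n := by
    intro a n hn; field_simp; ring
  have key2 : ∀ a n : ℝ, n ≠ 0 → (a - T ^ 2 / n) / n = (2 * n * a - 2 * T ^ 2) / (2 * n ^ 2) := by
    intro a n hn; field_simp
  have hsq : ∑ x : Fin M → Bool, (evalBool q x - T / 2 ^ M) ^ 2 =
      ∑ x : Fin M → Bool, evalBool q x ^ 2 - T ^ 2 / 2 ^ M := by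
    have e : ∀ x : Fin M → Bool, (evalBool q x - T / 2 ^ M) ^ 2 =
        evalBool q x ^ 2 + (T / 2 ^ M) ^ 2 - 2 * (T / 2 ^ M) * evalBool q x := by intro x; ring
    simp_rw [e]
    rw [Finset.sum_sub_distrib, Finset.sum_add_distrib, Finset.sum_const, Finset.card_univ, Fintype.card_fun,
      Fintype.card_bool, Fintype.card_fin, nsmul_eq_mul, ← Finset.mul_sum, ← hT]
    push_cast
    exact key1 _ _ h2
  rw [hsq]
  exact key2 _ _ h2

/-! ### The composite `Y = 1/2 + S(s)/2` -/

variable (s : MvPolynomial (Fin M) ℝ) (S : Polynomial ℝ)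

/-- The cube value of the composite: `Y(x) = 1/2 + S(s(x))/2`. [folklore] -/
theorem evalBool_clipPoly (x : Fin M → Bool) :
    evalBool (MvPolynomial.C (1 / 2 : ℝ) + MvPolynomial.C (1 / 2 : ℝ) * Polynomial.aeval s S) x =
      1 / 2 + S.eval (evalBool s x) / 2 := by
  unfold evalBool
  rw [map_add, map_mul, MvPolynomial.eval_C]
  have h : MvPolynomial.eval (fun i => if x i then (1 : ℝ) else 0) (Polynomial.aeval s S) =
      S.eval (MvPolynomial.eval (fun i => if x i then (1 : ℝ) else 0) s) := by
    rw [Polynomial.aeval_def, Polynomial.hom_eval₂]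
    have hc : (MvPolynomial.eval (fun i => if x i then (1 : ℝ) else 0)).comp
        (algebraMap ℝ (MvPolynomial (Fin M) ℝ)) = RingHom.id ℝ := by
      ext r; simp [MvPolynomial.algebraMap_eq]
    rw [hc]
    rfl
  rw [h]
  ring

/-- Degree of the composite: `≤ deg S · deg s`. [folklore] -/
theorem totalDegree_clipPoly_le :
    (MvPolynomial.C (1 / 2 : ℝ) + MvPolynomial.C (1 / 2 : ℝ) * Polynomial.aeval s S).totalDegree ≤
      S.natDegree * s.totalDegree := by
  refine (MvPolynomial.totalDegree_add _ _).trans (max_le (by simp) ?_)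
  refine (MvPolynomial.totalDegree_mul _ _).trans ?_
  rw [MvPolynomial.totalDegree_C, zero_add, Polynomial.aeval_eq_sum_range]
  refine (MvPolynomial.totalDegree_finsetSum _ _).trans (Finset.sup_le fun i hi => ?_)
  rw [Finset.mem_range] at hi
  refine (MvPolynomial.totalDegree_smul_le _ _).trans ((MvPolynomial.totalDegree_pow _ _).trans ?_)
  exact Nat.mul_le_mul_right _ (by omega)

variable {s S}

/-- Boundedness of the composite from `|S| ≤ 1` on `[−1,1]` and `|s| ≤ 1`. [folklore] -/
theorem clipPoly_bounds (hS1 : ∀ u : ℝ, |u| ≤ 1 → |S.eval u| ≤ 1) (hs : ∀ x, |evalBool s x| ≤ 1)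
    (x : Fin M → Bool) :
    0 ≤ evalBool (MvPolynomial.C (1 / 2 : ℝ) + MvPolynomial.C (1 / 2 : ℝ) * Polynomial.aeval s S) x ∧
      evalBool (MvPolynomial.C (1 / 2 : ℝ) + MvPolynomial.C (1 / 2 : ℝ) * Polynomial.aeval s S) x ≤ 1 := by
  rw [evalBool_clipPoly]
  obtain ⟨h1, h2⟩ := abs_le.mp (hS1 _ (hs x))
  constructor <;> linarith

/-- Influences of the composite from the Lipschitz bound: `Inf_j Y ≤ k² Inf_j s`. [folklore] -/
theorem influence_clipPoly_le {k : ℕ}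
    (hS2 : ∀ u v : ℝ, |u| ≤ 1 → |v| ≤ 1 → |S.eval u - S.eval v| ≤ 2 * k * |u - v|)
    (hs : ∀ x, |evalBool s x| ≤ 1) (j : Fin M) :
    influence j (MvPolynomial.C (1 / 2 : ℝ) + MvPolynomial.C (1 / 2 : ℝ) * Polynomial.aeval s S) ≤
      (k : ℝ) ^ 2 * influence j s := by
  unfold influence boolAvg
  rw [← mul_div_assoc, Finset.mul_sum]
  refine div_le_div_of_nonneg_right (Finset.sum_le_sum fun x _ => ?_) (by positivity)
  rw [evalBool_clipPoly, evalBool_clipPoly]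
  have h := hS2 _ _ (hs x) (hs (flipBit j x))
  have e : (1 / 2 + S.eval (evalBool s x) / 2 - (1 / 2 + S.eval (evalBool s (flipBit j x)) / 2)) ^ 2 =
      (S.eval (evalBool s x) - S.eval (evalBool s (flipBit j x))) ^ 2 / 4 := by ring
  rw [e]
  have h2 : (S.eval (evalBool s x) - S.eval (evalBool s (flipBit j x))) ^ 2 ≤
      (2 * k * |evalBool s x - evalBool s (flipBit j x)|) ^ 2 := by
    calc (S.eval (evalBool s x) - S.eval (evalBool s (flipBit j x))) ^ 2
        = |S.eval (evalBool s x) - S.eval (evalBool s (flipBit j x))| ^ 2 := (sq_abs _).symm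
      _ ≤ (2 * k * |evalBool s x - evalBool s (flipBit j x)|) ^ 2 :=
          pow_le_pow_left₀ (abs_nonneg _) h 2
  rw [mul_pow, sq_abs] at h2
  nlinarith [h2]

/-! ### The truncated second moment -/

/-- On the zone `|u|, |v| ≤ t ≤ 1/(2k)` the outer polynomial expands distances by `≥ k/16`, squared. [folklore] -/
theorem sq_sub_ge_of_zone {k : ℕ} {t : ℝ} (htk : t ≤ 1 / (2 * k))
    (hS4 : ∀ u v : ℝ, |u| ≤ 1 / (2 * k) → |v| ≤ 1 / (2 * k) → v ≤ u → k * (u - v) / 16 ≤ S.eval u - S.eval v)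
    {u v : ℝ} (hu : |u| ≤ t) (hv : |v| ≤ t) :
    ((k : ℝ) / 32) ^ 2 * (u - v) ^ 2 ≤ (1 / 2 + S.eval u / 2 - (1 / 2 + S.eval v / 2)) ^ 2 := by
  have hu' : |u| ≤ 1 / (2 * k) := hu.trans htk
  have hv' : |v| ≤ 1 / (2 * k) := hv.trans htk
  have e : (1 / 2 + S.eval u / 2 - (1 / 2 + S.eval v / 2)) ^ 2 = (S.eval u - S.eval v) ^ 2 / 4 := by ring
  rw [e]
  rcases le_total v u with h | h
  · have h1 := hS4 u v hu' hv' h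
    have h0 : 0 ≤ (k : ℝ) * (u - v) / 16 := by
      have : (0 : ℝ) ≤ k := Nat.cast_nonneg k
      have : 0 ≤ u - v := by linarith
      positivity
    have h2 : ((k : ℝ) * (u - v) / 16) ^ 2 ≤ (S.eval u - S.eval v) ^ 2 := pow_le_pow_left₀ h0 h1 2
    nlinarith [h2]
  · have h1 := hS4 v u hv' hu' h
    have h0 : 0 ≤ (k : ℝ) * (v - u) / 16 := by
      have : (0 : ℝ) ≤ k := Nat.cast_nonneg k
      have : 0 ≤ v - u := by linarith
      positivity
    have h2 : ((k : ℝ) * (v - u) / 16) ^ 2 ≤ (S.eval v - S.eval u) ^ 2 := pow_le_pow_left₀ h0 h1 2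
    nlinarith [h2]

/-- **The variance of the composite**: `Var Y ≥ (k/32)² (A·B − C²)`. [folklore: truncated second moment] -/
theorem boolVariance_clipPoly_ge {k : ℕ} {t : ℝ} (ht : 0 < t) (htk : t ≤ 1 / (2 * k))
    (hS4 : ∀ u v : ℝ, |u| ≤ 1 / (2 * k) → |v| ≤ 1 / (2 * k) → v ≤ u → k * (u - v) / 16 ≤ S.eval u - S.eval v)
    (hmean : boolAvg (evalBool s) = 0)
    (h4 : boolAvg (fun x => evalBool s x ^ 4) ≤ t ^ 2 * boolAvg (fun x => evalBool s x ^ 2))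
    (h2 : boolAvg (fun x => evalBool s x ^ 2) ≤ t ^ 2) :
    ((k : ℝ) / 32) ^ 2 *
        ((boolAvg (fun x => evalBool s x ^ 2) - boolAvg (fun x => evalBool s x ^ 4) / t ^ 2) *
            (1 - boolAvg (fun x => evalBool s x ^ 2) / t ^ 2) -
          (boolAvg (fun x => evalBool s x ^ 4) / t ^ 3) ^ 2) ≤
      boolVariance (MvPolynomial.C (1 / 2 : ℝ) + MvPolynomial.C (1 / 2 : ℝ) * Polynomial.aeval s S) := by
  classical
  -- notation
  set σ : (Fin M → Bool) → ℝ := evalBool s with hσ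
  set n : ℝ := (2 : ℝ) ^ M with hn
  have hn0 : 0 < n := by positivity
  set S2 : ℝ := ∑ x, σ x ^ 2 with hS2def
  set S4 : ℝ := ∑ x, σ x ^ 4 with hS4def
  have hE2 : boolAvg (fun x => evalBool s x ^ 2) = S2 / n := rfl
  have hE4 : boolAvg (fun x => evalBool s x ^ 4) = S4 / n := rfl
  have hsum0 : ∑ x, σ x = 0 := by
    have h : (∑ x, σ x) / n = 0 := hmean
    rcases div_eq_zero_iff.mp h with h | h
    · exact h
    · exact absurd h hn0.ne'
  -- the zone
  set Z : Finset (Fin M → Bool) := Finset.univ.filter (fun x => |σ x| ≤ t) with hZ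
  have hZc_mem : ∀ x, x ∉ Z → t < |σ x| := by
    intro x hx
    by_contra h
    exact hx (Finset.mem_filter.mpr ⟨Finset.mem_univ _, not_lt.mp h⟩)
  -- (a) Σ_Z σ² ≥ S2 − S4/t²
  have ha : S2 - S4 / t ^ 2 ≤ ∑ x ∈ Z, σ x ^ 2 := by
    have hsplit2 := Finset.sum_filter_add_sum_filter_not Finset.univ (fun x => |σ x| ≤ t) (fun x => σ x ^ 2)
    have hsplit4 := Finset.sum_filter_add_sum_filter_not Finset.univ (fun x => |σ x| ≤ t) (fun x => σ x ^ 4)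
    have hc : ∑ x ∈ Finset.univ.filter (fun x => ¬ |σ x| ≤ t), σ x ^ 2 ≤
        (∑ x ∈ Finset.univ.filter (fun x => ¬ |σ x| ≤ t), σ x ^ 4) / t ^ 2 := by
      rw [le_div_iff₀ (by positivity), Finset.sum_mul]
      refine Finset.sum_le_sum fun x hx => ?_
      have hx' : t < |σ x| := not_le.mp (Finset.mem_filter.mp hx).2
      have h1 : t ^ 2 ≤ σ x ^ 2 := by
        rw [← sq_abs (σ x)]; exact pow_le_pow_left₀ ht.le hx'.le 2
      nlinarith [sq_nonneg (σ x)]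
    have hpos : 0 ≤ ∑ x ∈ Finset.univ.filter (fun x => |σ x| ≤ t), σ x ^ 4 :=
      Finset.sum_nonneg fun x _ => by positivity
    rw [← hZ] at hsplit2
    have : S4 / t ^ 2 ≥ (∑ x ∈ Finset.univ.filter (fun x => ¬ |σ x| ≤ t), σ x ^ 4) / t ^ 2 := by
      rw [hS4def, ← hsplit4]
      exact div_le_div_of_nonneg_right (by linarith) (by positivity)
    linarith
  -- (b) |Z| ≥ n − S2/t²
  have hb : n - S2 / t ^ 2 ≤ Z.card := by
    have hcard := Finset.card_filter_add_card_filter_not (s := (Finset.univ : Finset (Fin M → Bool)))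
      (fun x => |σ x| ≤ t)
    rw [Finset.card_univ, Fintype.card_fun, Fintype.card_bool, Fintype.card_fin] at hcard
    have hc : ((Finset.univ.filter (fun x => ¬ |σ x| ≤ t)).card : ℝ) ≤ S2 / t ^ 2 := by
      rw [le_div_iff₀ (by positivity), hS2def,
        ← Finset.sum_filter_add_sum_filter_not Finset.univ (fun x => |σ x| ≤ t) (fun x => σ x ^ 2)]
      have h1 : ((Finset.univ.filter (fun x => ¬ |σ x| ≤ t)).card : ℝ) * t ^ 2 ≤
          ∑ x ∈ Finset.univ.filter (fun x => ¬ |σ x| ≤ t), σ x ^ 2 := by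
        rw [← nsmul_eq_mul, ← Finset.sum_const]
        refine Finset.sum_le_sum fun x hx => ?_
        have hx' : t < |σ x| := not_le.mp (Finset.mem_filter.mp hx).2
        rw [← sq_abs (σ x)]; exact pow_le_pow_left₀ ht.le hx'.le 2
      have h0 : 0 ≤ ∑ x ∈ Finset.univ.filter (fun x => |σ x| ≤ t), σ x ^ 2 :=
        Finset.sum_nonneg fun x _ => by positivity
      linarith
    have hcardR : (Z.card : ℝ) + ((Finset.univ.filter (fun x => ¬ |σ x| ≤ t)).card : ℝ) = n := by
      rw [hZ, hn]; exact_mod_cast hcard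
    linarith
  -- (c) |Σ_Z σ| ≤ S4/t³
  have hc : |∑ x ∈ Z, σ x| ≤ S4 / t ^ 3 := by
    have hsplit := Finset.sum_filter_add_sum_filter_not Finset.univ (fun x => |σ x| ≤ t) (fun x => σ x)
    rw [hsum0, ← hZ] at hsplit
    have heq : ∑ x ∈ Z, σ x = -∑ x ∈ Finset.univ.filter (fun x => ¬ |σ x| ≤ t), σ x := by linarith
    rw [heq, abs_neg]
    refine (Finset.abs_sum_le_sum_abs _ _).trans ?_
    rw [le_div_iff₀ (by positivity), Finset.sum_mul, hS4def,
      ← Finset.sum_filter_add_sum_filter_not Finset.univ (fun x => |σ x| ≤ t) (fun x => σ x ^ 4)]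
    have h1 : ∑ x ∈ Finset.univ.filter (fun x => ¬ |σ x| ≤ t), |σ x| * t ^ 3 ≤
        ∑ x ∈ Finset.univ.filter (fun x => ¬ |σ x| ≤ t), σ x ^ 4 := by
      refine Finset.sum_le_sum fun x hx => ?_
      have hx' : t < |σ x| := not_le.mp (Finset.mem_filter.mp hx).2
      have h3 : t ^ 3 ≤ |σ x| ^ 3 := pow_le_pow_left₀ ht.le hx'.le 3
      have e : σ x ^ 4 = |σ x| * |σ x| ^ 3 := by
        calc σ x ^ 4 = |σ x| ^ 4 := (Even.pow_abs ⟨2, rfl⟩ _).symm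
          _ = |σ x| * |σ x| ^ 3 := by ring
      rw [e]
      exact mul_le_mul_of_nonneg_left h3 (abs_nonneg _)
    have h0 : 0 ≤ ∑ x ∈ Finset.univ.filter (fun x => |σ x| ≤ t), σ x ^ 4 :=
      Finset.sum_nonneg fun x _ => by positivity
    linarith
  -- nonnegativity of A and B
  have hA0 : 0 ≤ S2 - S4 / t ^ 2 := by
    rw [hE2, hE4] at h4
    have : S4 / n ≤ t ^ 2 * (S2 / n) := h4
    rw [div_le_iff₀ hn0] at this
    have h' : S4 ≤ t ^ 2 * S2 := by
      calc S4 ≤ t ^ 2 * (S2 / n) * n := this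
        _ = t ^ 2 * S2 := by field_simp
    rw [sub_nonneg, div_le_iff₀ (by positivity)]; linarith
  have hB0 : 0 ≤ n - S2 / t ^ 2 := by
    rw [hE2] at h2
    rw [sub_nonneg, div_le_iff₀ (by positivity)]
    rw [div_le_iff₀ hn0] at h2; linarith
  -- the zone double sum
  have hzone : 2 * (n - S2 / t ^ 2) * (S2 - S4 / t ^ 2) - 2 * (S4 / t ^ 3) ^ 2 ≤
      ∑ x ∈ Z, ∑ x' ∈ Z, (σ x - σ x') ^ 2 := by
    rw [sum_sum_sq_sub]
    have h1 : (n - S2 / t ^ 2) * (S2 - S4 / t ^ 2) ≤ Z.card * ∑ x ∈ Z, σ x ^ 2 :=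
      mul_le_mul hb ha hA0 (by positivity)
    have h2' : (∑ x ∈ Z, σ x) ^ 2 ≤ (S4 / t ^ 3) ^ 2 := by
      rw [← sq_abs (∑ x ∈ Z, σ x)]
      exact pow_le_pow_left₀ (abs_nonneg _) hc 2
    linarith
  -- from the zone to the full double sum of `Y`
  have hmono : ((k : ℝ) / 32) ^ 2 * ∑ x ∈ Z, ∑ x' ∈ Z, (σ x - σ x') ^ 2 ≤
      ∑ x : Fin M → Bool, ∑ x' : Fin M → Bool,
        (evalBool (MvPolynomial.C (1 / 2 : ℝ) + MvPolynomial.C (1 / 2 : ℝ) * Polynomial.aeval s S) x -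
          evalBool (MvPolynomial.C (1 / 2 : ℝ) + MvPolynomial.C (1 / 2 : ℝ) * Polynomial.aeval s S) x') ^ 2 := by
    simp_rw [evalBool_clipPoly]
    rw [Finset.mul_sum]
    calc ∑ x ∈ Z, ((k : ℝ) / 32) ^ 2 * ∑ x' ∈ Z, (σ x - σ x') ^ 2
        ≤ ∑ x ∈ Z, ∑ x' ∈ Z, (1 / 2 + S.eval (σ x) / 2 - (1 / 2 + S.eval (σ x') / 2)) ^ 2 := by
          refine Finset.sum_le_sum fun x hx => ?_
          rw [Finset.mul_sum]
          refine Finset.sum_le_sum fun x' hx' => ?_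
          exact sq_sub_ge_of_zone htk hS4 (Finset.mem_filter.mp hx).2 (Finset.mem_filter.mp hx').2
      _ ≤ ∑ x, ∑ x' ∈ Z, (1 / 2 + S.eval (σ x) / 2 - (1 / 2 + S.eval (σ x') / 2)) ^ 2 :=
          Finset.sum_le_sum_of_subset_of_nonneg (Finset.filter_subset _ _)
            (fun x _ _ => Finset.sum_nonneg fun x' _ => sq_nonneg _)
      _ ≤ ∑ x, ∑ x', (1 / 2 + S.eval (σ x) / 2 - (1 / 2 + S.eval (σ x') / 2)) ^ 2 :=
          Finset.sum_le_sum fun x _ => Finset.sum_le_sum_of_subset_of_nonneg (Finset.filter_subset _ _)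
            (fun x' _ _ => sq_nonneg _)
  -- assemble
  rw [boolVariance_eq_double_sum, hE2, hE4, le_div_iff₀ (by positivity)]
  have hrew : (S2 / n - S4 / n / t ^ 2) * (1 - S2 / n / t ^ 2) - (S4 / n / t ^ 3) ^ 2 =
      ((n - S2 / t ^ 2) * (S2 - S4 / t ^ 2) - (S4 / t ^ 3) ^ 2) / n ^ 2 := by
    field_simp
  rw [hrew]
  have hk0 : 0 ≤ ((k : ℝ) / 32) ^ 2 := sq_nonneg _
  calc ((k : ℝ) / 32) ^ 2 * (((n - S2 / t ^ 2) * (S2 - S4 / t ^ 2) - (S4 / t ^ 3) ^ 2) / n ^ 2) * (2 * n ^ 2)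
      = ((k : ℝ) / 32) ^ 2 * (2 * (n - S2 / t ^ 2) * (S2 - S4 / t ^ 2) - 2 * (S4 / t ^ 3) ^ 2) := by
        field_simp
    _ ≤ ((k : ℝ) / 32) ^ 2 * ∑ x ∈ Z, ∑ x' ∈ Z, (σ x - σ x') ^ 2 := mul_le_mul_of_nonneg_left hzone hk0
    _ ≤ _ := hmono

end StubClip

open StubClip in
/-- **Stub `stub_clip` of line `average-and-clip`** (registered signature, BY NAME): clipping a mean-zero
`[−1,1]`-valued cube polynomial `s` through an admissible outer polynomial of gain `k` gives a `[0,1]`-bounded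
polynomial `Y = 1/2 + S(s)/2` of total degree `≤ deg S · deg s`, with `Inf_j Y ≤ k² Inf_j s` and
`Var Y ≥ (k/32)²(A·B − C²)` (truncated second moment at scale `t ≤ 1/(2k)`). [folklore] -/
theorem stub_clip :
    ∀ (N' : ℕ) (s : MvPolynomial (Fin N') ℝ) (S : Polynomial ℝ) (k : ℕ) (t : ℝ), 1 ≤ k →
      ((∀ u : ℝ, |u| ≤ 1 → |S.eval u| ≤ 1) ∧
        (∀ u v : ℝ, |u| ≤ 1 → |v| ≤ 1 → |S.eval u - S.eval v| ≤ 2 * k * |u - v|) ∧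
        (∀ u v : ℝ, -1 ≤ v → v ≤ u → u ≤ 1 → (u - v) / 64 ≤ S.eval u - S.eval v) ∧
        (∀ u v : ℝ, |u| ≤ 1 / (2 * k) → |v| ≤ 1 / (2 * k) → v ≤ u → k * (u - v) / 16 ≤ S.eval u - S.eval v)) →
      (∀ x, |evalBool s x| ≤ 1) → boolAvg (evalBool s) = 0 → 0 < t → t ≤ 1 / (2 * k) →
      boolAvg (fun x => evalBool s x ^ 4) ≤ t ^ 2 * boolAvg (fun x => evalBool s x ^ 2) →
      boolAvg (fun x => evalBool s x ^ 2) ≤ t ^ 2 →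
      ∃ Y : MvPolynomial (Fin N') ℝ, Y.totalDegree ≤ S.natDegree * s.totalDegree ∧
        (∀ x, 0 ≤ evalBool Y x ∧ evalBool Y x ≤ 1) ∧
        (∀ j, influence j Y ≤ (k : ℝ) ^ 2 * influence j s) ∧
        ((k : ℝ) / 32) ^ 2 *
            ((boolAvg (fun x => evalBool s x ^ 2) - boolAvg (fun x => evalBool s x ^ 4) / t ^ 2) *
                (1 - boolAvg (fun x => evalBool s x ^ 2) / t ^ 2) -
              (boolAvg (fun x => evalBool s x ^ 4) / t ^ 3) ^ 2) ≤ boolVariance Y := by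
  intro N' s S k t _hk hS hs hmean ht htk h4 h2
  obtain ⟨hS1, hS2, -, hS4⟩ := hS
  exact ⟨MvPolynomial.C (1 / 2 : ℝ) + MvPolynomial.C (1 / 2 : ℝ) * Polynomial.aeval s S,
    totalDegree_clipPoly_le s S, clipPoly_bounds hS1 hs, influence_clipPoly_le hS2 hs,
    boolVariance_clipPoly_ge ht htk hS4 hmean h4 h2⟩

end Summit.QuantumAdvantage.QuantumAdvantage.Cruxes.VarianceAmplification.AverageAndClip

end
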